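import Mathlib.Analysis.Fourier.AddCircleMulti
import Mathlib.Analysis.InnerProductSpace.PiL2
import Mathlib.Analysis.Calculus.ContDiff.Basic
import Mathlib.Analysis.Calculus.ContDiff.Operations
import Mathlib.Analysis.Calculus.ContDiff.WithLp
import Mathlib.Analysis.SpecialFunctions.ExpDeriv
import Mathlib.MeasureTheory.Integral.IntervalIntegral.Periodic
import Mathlib.MeasureTheory.Measure.Haar.InnerProductSpace
import HarnessLib

-- provenance: harness21/H21/H21/Prelude/Sobolev/FlatTorus.lean @ 7fd1621 (interim HEAD d8f2665); M5 mechanical rewrite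
/-!
# The flat torus `T^d`  (trunk: Sobolev, concept C1 / notion `flat_torus_T3`)

The flat `d`-torus is Mathlib's `UnitAddTorus d = d → AddCircle (1 : ℝ)` (a compact metrisable
abelian group with its product `volume`, total mass `1`). Mathlib provides the group, topology,
measure and multivariate Fourier series (`UnitAddTorus.mFourier`, `mFourierCoeff`,
`mFourierBasis`), but no differential calculus on `AddCircle`. Following the outline
(`H21/Outlines/Sobolev.md`, D2 and §C1) we do **not** build a `ChartedSpace`; instead all
smoothness is expressed through the periodic lift along the covering map
`Torus.proj : EuclideanSpace ℝ d → UnitAddTorus d`: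

* `Torus.lift f := f ∘ proj` (global `ℤ^d`-periodic lift, used for smoothness and integrals);
* `Torus.liftAt f x v := f (x + proj v)` (chart centred at `x`, used for derivatives in
  `TorusCalculus`);
* `Torus.IsSmooth f := ContDiff ℝ ∞ (lift f)`, `Torus.IsContDiff n f := ContDiff ℝ n (lift f)`;
* `Torus.IsLatticePeriodic g` (verbatim the accepted `Literature.Analysis.FluidPDE.IsLatticePeriodic`) and the descent
  `Torus.descend` of a lattice-periodic function to the torus.

This file is the canonical home of the torus glue: `Literature.Analysis.FluidPDE.toTorus` (Statements/Turb/Wave0) and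
`Literature.Analysis.FluidPDE.IsLatticePeriodic` (Statements/NS/Wave0) are definitionally equal to `Torus.proj ∘ toLp`
and `Torus.IsLatticePeriodic` respectively and will be re-based on this file.

## Measure

Globally `volume` on `UnitAddCircle` is `ENNReal.ofReal 1 • AddCircle.haarAddCircle`
(`AddCircle.volume_eq_smul_haarAddCircle`); Mathlib's `AddCircleMulti` works with the *local*
instance `volume := haarAddCircle`. H21 uses the global `volume` only (outline §4.2). We add the
(missing, non-overriding) instance `IsProbabilityMeasure (volume : Measure UnitAddCircle)` with a
real proof and record `Torus.volume_eq_pi_haarAddCircle` for transport.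

## References

* L. Grafakos, *Classical Fourier Analysis* (3rd ed., 2014), §3.1 (the torus `T^n = ℝ^n/ℤ^n`,
  functions on `T^n` as `1`-periodic functions on `ℝ^n`).
* C. Fefferman, *Existence and smoothness of the Navier–Stokes equation* (Clay, 2000/2006),
  eqs. (8), (10) (lattice periodicity).
-/

open MeasureTheory Set Topology
open scoped ContDiff

namespace Literature.Analysis.FunctionSpaces

/-! ## Measure on the unit circle and torus -/

/-- The global `volume` on `UnitAddCircle = AddCircle (1 : ℝ)` (Haar measure of total mass
`ENNReal.ofReal 1`, `AddCircle.measureSpace`) is a probability measure. Mathlib only has this as a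
`local instance` in `Mathlib.Analysis.Fourier.AddCircleMulti` (for the local `haarAddCircle`
measure space); this instance is about the *global* measure space and does not override anything.
(Grafakos, *Classical Fourier Analysis*, §3.1.) [folklore] -/
instance instIsProbabilityMeasureVolumeUnitAddCircle :
    IsProbabilityMeasure (volume : Measure UnitAddCircle) := by
  constructor
  rw [AddCircle.volume_eq_smul_haarAddCircle]
  simp

/-- The torus `UnitAddTorus d` carries a probability measure (product instance). -/
example {d : Type*} [Fintype d] : IsProbabilityMeasure (volume : Measure (UnitAddTorus d)) :=
  inferInstance

noncomputable section

namespace Torus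

variable {d : Type*}
variable {F : Type*}

section Proj

/-! ## The covering map and the lattice -/

/-- The covering map `ℝ^d → T^d = ℝ^d/ℤ^d`, coordinatewise the quotient map `ℝ → ℝ/ℤ`
(Grafakos, *Classical Fourier Analysis*, §3.1). Twin: `Literature.Analysis.FluidPDE.toTorus` (Statements/Turb/Wave0),
with `proj (WithLp.toLp 2 v) = Turb.toTorus v` by `rfl`. [folklore] -/
def proj (x : EuclideanSpace ℝ d) : UnitAddTorus d := fun i => ((x i : ℝ) : UnitAddCircle)

/-- `proj` evaluated at a coordinate. [folklore] -/
@[simp]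
theorem proj_apply (x : EuclideanSpace ℝ d) (i : d) : proj x i = ((x i : ℝ) : UnitAddCircle) :=
  rfl

/-- `proj (toLp 2 v) = fun i ↦ (v i : UnitAddCircle)`; the right-hand side is literally
`Literature.Turb.toTorus v` (Statements/Turb/Wave0), so the bridge is `rfl`. [folklore] -/
theorem proj_toLp (v : d → ℝ) : proj (WithLp.toLp 2 v) = fun i => ((v i : ℝ) : UnitAddCircle) :=
  rfl

/-- The covering map `ℝ^d → T^d` is continuous (Grafakos, §3.1). [folklore] -/
theorem continuous_proj : Continuous (proj : EuclideanSpace ℝ d → UnitAddTorus d) := by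
  unfold proj
  fun_prop

/-- The covering map `ℝ^d → T^d` is an open quotient map (product of the open quotient maps
`ℝ → ℝ/ℤ`, `QuotientAddGroup.isOpenQuotientMap_mk`). [folklore] -/
theorem isOpenQuotientMap_proj :
    IsOpenQuotientMap (proj : EuclideanSpace ℝ d → UnitAddTorus d) := by
  have h1 : IsOpenQuotientMap
      (Pi.map fun (_ : d) (t : ℝ) => (t : UnitAddCircle) : (d → ℝ) → UnitAddTorus d) :=
    IsOpenQuotientMap.piMap fun _ => QuotientAddGroup.isOpenQuotientMap_mk
  exact h1.comp (PiLp.homeomorph 2 (fun _ : d => ℝ)).isOpenQuotientMap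

/-- The covering map `ℝ^d → T^d` is surjective (Grafakos, §3.1). [folklore] -/
theorem proj_surjective : Function.Surjective (proj : EuclideanSpace ℝ d → UnitAddTorus d) := by
  intro x
  refine ⟨WithLp.toLp 2 fun i => Classical.choose (QuotientAddGroup.mk_surjective (x i)), ?_⟩
  funext i
  exact Classical.choose_spec (QuotientAddGroup.mk_surjective (x i))

/-- The covering map is additive: `proj (x + y) = proj x + proj y`. [folklore] -/
@[simp]
theorem proj_add (x y : EuclideanSpace ℝ d) : proj (x + y) = proj x + proj y := rfl

/-- The covering map sends `0` to `0`. [folklore] -/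
@[simp]
theorem proj_zero : proj (0 : EuclideanSpace ℝ d) = 0 := rfl

/-- The covering map commutes with negation. [folklore] -/
@[simp]
theorem proj_neg (x : EuclideanSpace ℝ d) : proj (-x) = -proj x := rfl

/-- The covering map is `ℝ`-homogeneous along lines: `proj (t • x) i = t • x i (mod 1)`. [folklore] -/
theorem proj_smul_apply (t : ℝ) (x : EuclideanSpace ℝ d) (i : d) :
    proj (t • x) i = ((t * x i : ℝ) : UnitAddCircle) := rfl

end Proj

variable [Fintype d] [DecidableEq d]

omit [DecidableEq d] in
/-- The covering map `ℝ^d → T^d` is measurable. [folklore] -/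
theorem measurable_proj : Measurable (proj : EuclideanSpace ℝ d → UnitAddTorus d) :=
  continuous_proj.measurable

/-- The lattice vector `∑ⱼ kⱼ eⱼ ∈ ℤ^d ⊂ ℝ^d` attached to `k : d → ℤ`, written with the standard
basis `EuclideanSpace.single j 1` (the convention of `Literature.Analysis.FluidPDE.IsLatticePeriodic`)
(Fefferman, eq. (8)). [folklore] -/
def latticeVec (k : d → ℤ) : EuclideanSpace ℝ d :=
  ∑ j, (k j : ℝ) • EuclideanSpace.single j (1 : ℝ)

/-- Coordinates of a lattice vector: `(latticeVec k) i = k i`. [folklore] -/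
@[simp]
theorem latticeVec_apply (k : d → ℤ) (i : d) : latticeVec k i = k i := by
  simp [latticeVec, Finset.sum_apply, Pi.single_apply]

/-- `latticeVec` is additive. [folklore] -/
theorem latticeVec_add (k l : d → ℤ) : latticeVec (k + l) = latticeVec k + latticeVec l := by
  ext i
  simp

/-- `latticeVec 0 = 0`. [folklore] -/
@[simp]
theorem latticeVec_zero : latticeVec (0 : d → ℤ) = 0 := by
  ext i
  simp

/-- A standard basis vector is the lattice vector of `Pi.single j 1`. [folklore] -/
theorem latticeVec_single (j : d) :
    latticeVec (Pi.single j 1 : d → ℤ) = EuclideanSpace.single j (1 : ℝ) := by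
  ext i
  simp [PiLp.single_apply, Pi.single_apply]

/-- Lattice vectors project to `0 ∈ T^d`. [folklore] -/
@[simp]
theorem proj_latticeVec (k : d → ℤ) : proj (latticeVec k) = 0 := by
  funext i
  simp only [proj_apply, latticeVec_apply, Pi.zero_apply]
  exact (AddCircle.coe_eq_zero_iff (1 : ℝ)).2 ⟨k i, by simp⟩

/-- The covering map is invariant under lattice translations: `proj (x + latticeVec k) = proj x`
(Grafakos, §3.1). [folklore] -/
theorem proj_add_latticeVec (x : EuclideanSpace ℝ d) (k : d → ℤ) :
    proj (x + latticeVec k) = proj x := by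
  simp

/-- Two points of `ℝ^d` have the same image in `T^d` iff they differ by a lattice vector
(Grafakos, §3.1). [cite: Grafakos2014, §3.1.1] -/
def proj_eq_proj_iff : Prop :=
  ∀ (x y : EuclideanSpace ℝ d),
    proj x = proj y ↔ ∃ k : d → ℤ, y = x + latticeVec k

/-- Discharge of the named fact `proj_eq_proj_iff`: `x, y ∈ ℝⁿ` define the same point of the
torus `Tⁿ = ℝⁿ/ℤⁿ` iff `x ≡ y`, i.e. `x - y ∈ ℤⁿ` (Grafakos, *Classical Fourier Analysis*,
3rd ed., §3.1.1, p. 174, eq. (3.1.1): "We say that `x, y` in `ℝⁿ` are equivalent and we write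
`x ≡ y` if `x − y ∈ ℤⁿ` … The `n`-torus `Tⁿ` is then defined as the set `ℝⁿ/ℤⁿ` of all such
equivalence classes"). Proof: `proj` is coordinatewise the quotient map `ℝ → ℝ/ℤ`, so
`proj x = proj y` iff for every `i` the real number `y i - x i` maps to `0` in `AddCircle 1`,
i.e. (`AddCircle.coe_eq_zero_iff`) `y i - x i = k i` for some `k i : ℤ`; then
`y = x + latticeVec k` by `latticeVec_apply`. The converse is `proj_add_latticeVec`.
[cite: Grafakos2014, §3.1.1, eq. (3.1.1)] -/
theorem proj_eq_proj_iff_holds : proj_eq_proj_iff (d := d) := by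
  intro x y
  constructor
  · intro h
    have h' : ∀ i, ∃ n : ℤ, (n : ℝ) = y i - x i := by
      intro i
      have hi : ((x i : ℝ) : UnitAddCircle) = ((y i : ℝ) : UnitAddCircle) := congrFun h i
      have h0 : ((y i - x i : ℝ) : UnitAddCircle) = 0 := by
        rw [AddCircle.coe_sub, hi, sub_self]
      obtain ⟨n, hn⟩ := (AddCircle.coe_eq_zero_iff (1 : ℝ)).1 h0
      exact ⟨n, by simpa using hn⟩
    choose k hk using h'
    refine ⟨k, ?_⟩
    ext i
    rw [PiLp.add_apply, latticeVec_apply, hk, add_sub_cancel]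
  · rintro ⟨k, rfl⟩
    exact (proj_add_latticeVec x k).symm

/-! ## Lattice periodicity -/

/-- `ℤ^d`-periodicity of a function on `EuclideanSpace ℝ d` (Fefferman, eqs. (8), (10)):
`g (x + eⱼ) = g x` for every standard basis vector `eⱼ`. **Verbatim** the accepted
`Literature.Analysis.FluidPDE.IsLatticePeriodic` (Statements/NS/Wave0), which is to be re-based on this definition
(`Iff.rfl`). [folklore] -/
def IsLatticePeriodic (g : EuclideanSpace ℝ d → F) : Prop :=
  ∀ j x, g (x + EuclideanSpace.single j 1) = g x

/-- A lattice-periodic function is invariant under all lattice translations. [cite: Grafakos2014, §3.1.1] -/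
def IsLatticePeriodic.add_latticeVec : Prop :=
  ∀ {g : EuclideanSpace ℝ d → F} (hg : IsLatticePeriodic g) (x : EuclideanSpace ℝ d) (k : d → ℤ),
    g (x + latticeVec k) = g x

omit [Fintype d] in
/-- Along each coordinate line a lattice-periodic function is invariant under every *integer*
translate of the basis vector: `g (x + n • eⱼ) = g x` for `n : ℤ` (the restriction
`t ↦ g (x + t • eⱼ)` is `1`-periodic on `ℝ`, `Function.Periodic.int_mul`). [folklore] -/
theorem IsLatticePeriodic.add_int_smul_single {g : EuclideanSpace ℝ d → F}
    (hg : IsLatticePeriodic g) (j : d) (n : ℤ) (x : EuclideanSpace ℝ d) :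
    g (x + (n : ℝ) • EuclideanSpace.single j (1 : ℝ)) = g x := by
  have hper : Function.Periodic (fun t : ℝ => g (x + t • EuclideanSpace.single j (1 : ℝ))) 1 :=
    fun t => by simpa only [add_smul, one_smul, ← add_assoc] using hg j _
  simpa using (hper.int_mul n).eq

/-- Discharge of the named fact `IsLatticePeriodic.add_latticeVec`: a function on `ℝ^d` that is
`1`-periodic in every coordinate satisfies `g (x + m) = g x` for all `m = ∑ⱼ kⱼ eⱼ ∈ ℤ^d`
(Grafakos, *Classical Fourier Analysis*, 3rd ed., §3.1.1, p. 175: "functions `f` on `ℝⁿ` that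
satisfy `f (x + m) = f x` for all `x ∈ ℝⁿ` and `m ∈ ℤⁿ` … are called `1`-periodic in every
coordinate"). Proof: `IsLatticePeriodic.add_int_smul_single` and induction on the finite sum
defining `latticeVec`. [cite: Grafakos2014, §3.1.1] -/
theorem IsLatticePeriodic.add_latticeVec_holds :
    IsLatticePeriodic.add_latticeVec (d := d) (F := F) := by
  intro g hg x k
  unfold latticeVec
  suffices h : ∀ (s : Finset d) (x : EuclideanSpace ℝ d),
      g (x + ∑ j ∈ s, (k j : ℝ) • EuclideanSpace.single j (1 : ℝ)) = g x from h Finset.univ x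
  intro s
  induction s using Finset.induction_on with
  | empty => intro x; simp
  | insert j s hj ih =>
      intro x
      rw [Finset.sum_insert hj, add_comm (_ • _), ← add_assoc, hg.add_int_smul_single, ih]

/-- A lattice-periodic function is constant on the fibres of `proj`. [folklore] -/
def IsLatticePeriodic.eq_of_proj_eq : Prop :=
  ∀ {g : EuclideanSpace ℝ d → F} (hg : IsLatticePeriodic g) {x y : EuclideanSpace ℝ d} (h : proj x = proj y),
    g x = g y

/- interim proof relied on results that are now named facts (D-0014); demoted to a fact by the M5 import, proof preserved:
:= by
  obtain ⟨k, rfl⟩ := (proj_eq_proj_iff x y).1 h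
  exact (hg.add_latticeVec x k).symm
-/

/-! ## Fundamental-domain representative -/

omit [DecidableEq d] in
/-- The representative of a point of `T^d` in the fundamental domain `[0,1)^d ⊂ ℝ^d`,
coordinatewise `AddCircle.equivIco 1 0` (Grafakos, §3.1: `T^n` identified with `[0,1]^n`).
Used **only** to write torus integrals as integrals over the unit cube; all calculus is
representative-free (via `liftAt`). [folklore] -/
def repr (x : UnitAddTorus d) : EuclideanSpace ℝ d :=
  WithLp.toLp 2 fun i => ((AddCircle.equivIco (1 : ℝ) (0 : ℝ) (x i) : ℝ))

omit [Fintype d] [DecidableEq d] in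
/-- Coordinates of the representative. [folklore] -/
theorem repr_apply (x : UnitAddTorus d) (i : d) :
    repr x i = ((AddCircle.equivIco (1 : ℝ) (0 : ℝ) (x i) : ℝ)) := rfl

omit [Fintype d] [DecidableEq d] in
/-- `repr` is a section of the covering map: `proj (repr x) = x`. [folklore] -/
@[simp]
theorem proj_repr (x : UnitAddTorus d) : proj (repr x) = x := by
  funext i
  simp only [proj_apply, repr_apply]
  exact (AddCircle.equivIco (1 : ℝ) (0 : ℝ)).symm_apply_apply (x i)

omit [Fintype d] [DecidableEq d] in
/-- The coordinates of the representative lie in `[0, 1)`. [folklore] -/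
theorem repr_apply_mem_Ico (x : UnitAddTorus d) (i : d) : repr x i ∈ Ico (0 : ℝ) 1 := by
  have h := (AddCircle.equivIco (1 : ℝ) (0 : ℝ) (x i)).2
  simpa [repr_apply] using h

omit [Fintype d] [DecidableEq d] in
/-- `repr` is measurable. [folklore] -/
theorem measurable_repr : Measurable (repr : UnitAddTorus d → EuclideanSpace ℝ d) := by
  refine (WithLp.measurable_toLp 2 (d → ℝ)).comp (measurable_pi_lambda _ fun i => ?_)
  exact measurable_subtype_coe.comp
    ((AddCircle.measurableEquivIco (1 : ℝ) 0).measurable.comp (measurable_pi_apply i))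

/-- `repr (proj y)` differs from `y` by a lattice vector. [folklore] -/
def exists_repr_proj_eq_add_latticeVec : Prop :=
  ∀ (y : EuclideanSpace ℝ d),
    ∃ k : d → ℤ, repr (proj y) = y + latticeVec k

/- interim proof relied on results that are now named facts (D-0014); demoted to a fact by the M5 import, proof preserved:
:=
  (proj_eq_proj_iff y (repr (proj y))).1 (proj_repr (proj y)).symm
-/

/-! ## The unit cube -/

omit [Fintype d] [DecidableEq d] in
/-- The half-open unit cube `[0,1)^d ⊂ ℝ^d`, a fundamental domain for `ℤ^d`
(Grafakos, §3.1). (No `Fintype` hypothesis is needed for the definition itself.) [folklore] -/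
def unitCube (d : Type*) : Set (EuclideanSpace ℝ d) := {y | ∀ i, y i ∈ Ico (0 : ℝ) 1}

omit [Fintype d] [DecidableEq d] in
/-- Membership in the unit cube. [folklore] -/
@[simp]
theorem mem_unitCube {y : EuclideanSpace ℝ d} : y ∈ unitCube d ↔ ∀ i, y i ∈ Ico (0 : ℝ) 1 :=
  Iff.rfl

omit [DecidableEq d] in
/-- The unit cube is measurable. [folklore] -/
theorem measurableSet_unitCube : MeasurableSet (unitCube d) := by
  have : unitCube d = ⋂ i, (fun y : EuclideanSpace ℝ d => y i) ⁻¹' Ico 0 1 := by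
    ext y
    simp
  rw [this]
  exact MeasurableSet.iInter fun i => measurableSet_Ico.preimage (by fun_prop)

omit [Fintype d] [DecidableEq d] in
/-- Representatives lie in the unit cube. [folklore] -/
theorem repr_mem_unitCube (x : UnitAddTorus d) : repr x ∈ unitCube d :=
  fun i => repr_apply_mem_Ico x i

omit [Fintype d] [DecidableEq d] in
/-- On the unit cube, `repr ∘ proj` is the identity. [cite: Grafakos2014, §3.1.1] -/
def repr_proj_of_mem_unitCube : Prop :=
  ∀ {y : EuclideanSpace ℝ d} (hy : y ∈ unitCube d),
    repr (proj y) = y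

/-! ## Lifts -/

section Lift

omit [Fintype d] [DecidableEq d]

/-- The global periodic lift of `f : T^d → F` to `ℝ^d`, `lift f := f ∘ proj`
(Grafakos, §3.1: functions on `T^n` are `1`-periodic functions on `ℝ^n`). [folklore] -/
def lift (f : UnitAddTorus d → F) : EuclideanSpace ℝ d → F := f ∘ proj

/-- `lift f y = f (proj y)`. [folklore] -/
@[simp]
theorem lift_apply (f : UnitAddTorus d → F) (y : EuclideanSpace ℝ d) : lift f y = f (proj y) :=
  rfl

/-- The lift re-centred at `x ∈ T^d`: `liftAt f x v := f (x + proj v)`. This is the chart in which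
all derivatives of `TorusCalculus` are taken (at `v = 0`); it matches the accepted
`Literature.Turb.torusLineDeriv u x v = deriv (fun t ↦ u (x + toTorus (t • v))) 0`. [folklore] -/
def liftAt (f : UnitAddTorus d → F) (x : UnitAddTorus d) : EuclideanSpace ℝ d → F :=
  fun v => f (x + proj v)

/-- `liftAt f x v = f (x + proj v)`. [folklore] -/
@[simp]
theorem liftAt_apply (f : UnitAddTorus d → F) (x : UnitAddTorus d) (v : EuclideanSpace ℝ d) :
    liftAt f x v = f (x + proj v) :=
  rfl

/-- `liftAt f x 0 = f x`. [folklore] -/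
theorem liftAt_apply_zero (f : UnitAddTorus d → F) (x : UnitAddTorus d) : liftAt f x 0 = f x := by
  simp

/-- The lift centred at `0` is the global lift. [folklore] -/
@[simp]
theorem liftAt_zero_left (f : UnitAddTorus d → F) : liftAt f 0 = lift f := by
  funext v
  simp

/-- The lift centred at `x = proj y` is the global lift precomposed with translation by `y`. [folklore] -/
theorem liftAt_eq_lift_comp_add (f : UnitAddTorus d → F) {x : UnitAddTorus d}
    (y : EuclideanSpace ℝ d) (hy : proj y = x) : liftAt f x = lift f ∘ (y + ·) := by
  funext v
  simp [← hy]

/-- `liftAt f (proj y) v = lift f (y + v)`. [folklore] -/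
theorem liftAt_proj (f : UnitAddTorus d → F) (y : EuclideanSpace ℝ d) :
    liftAt f (proj y) = lift f ∘ (y + ·) :=
  liftAt_eq_lift_comp_add f y rfl

end Lift

omit [Fintype d] [DecidableEq d] in
/-- `lift f (repr x) = f x` (provable by `simp` from `lift_apply` and `proj_repr`, hence not a
`simp` lemma). [folklore] -/
theorem lift_repr (f : UnitAddTorus d → F) (x : UnitAddTorus d) : lift f (repr x) = f x := by
  simp

omit [Fintype d] [DecidableEq d] in
/-- `lift` is injective (since `proj` is surjective). [folklore] -/
theorem lift_injective : Function.Injective (lift : (UnitAddTorus d → F) → EuclideanSpace ℝ d → F) :=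
  fun f g h => funext fun x => by simpa using congrFun h (repr x)

omit [Fintype d] in
/-- Lifts are lattice periodic (real proof; Fefferman, eq. (8)). [folklore] -/
theorem isLatticePeriodic_lift (f : UnitAddTorus d → F) : IsLatticePeriodic (lift f) := by
  intro j x
  simp only [lift, Function.comp_apply]
  congr 1
  funext i
  simp only [proj, PiLp.add_apply, PiLp.single_apply]
  split_ifs <;> simp

/-- The descent of a lattice-periodic function `g : ℝ^d → F` to the torus (the unique `f` with
`lift f = g`, see `lift_descend`); implemented as `g ∘ repr`. The periodicity hypothesis is not
used in the definition but is part of the interface. [folklore] -/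
def descend (g : EuclideanSpace ℝ d → F) (_hg : IsLatticePeriodic g) : UnitAddTorus d → F :=
  g ∘ repr

omit [Fintype d] in
/-- `descend g hg x = g (repr x)`. [folklore] -/
theorem descend_apply (g : EuclideanSpace ℝ d → F) (hg : IsLatticePeriodic g)
    (x : UnitAddTorus d) : descend g hg x = g (repr x) := rfl

/-- The descent lifts back to `g`. [folklore] -/
def lift_descend : Prop :=
  ∀ (g : EuclideanSpace ℝ d → F) (hg : IsLatticePeriodic g),
    lift (descend g hg) = g

/- interim proof relied on results that are now named facts (D-0014); demoted to a fact by the M5 import, proof preserved: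
:= by
  funext y
  exact hg.eq_of_proj_eq (proj_repr (proj y))
-/

/-- `descend (lift f) = f`. [folklore] -/
def descend_lift : Prop :=
  ∀ (f : UnitAddTorus d → F),
    descend (lift f) (isLatticePeriodic_lift f) = f

/- interim proof relied on results that are now named facts (D-0014); demoted to a fact by the M5 import, proof preserved:
:=
  lift_injective (lift_descend _ _)
-/

/-- Descent: a lattice-periodic function on `ℝ^d` is the lift of a unique function on `T^d`
(Grafakos, §3.1). [folklore] -/
def exists_lift_eq_of_isLatticePeriodic : Prop :=
  ∀ {g : EuclideanSpace ℝ d → F} (hg : IsLatticePeriodic g),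
    ∃! f : UnitAddTorus d → F, lift f = g

/- interim proof relied on results that are now named facts (D-0014); demoted to a fact by the M5 import, proof preserved:
:=
  ⟨descend g hg, lift_descend g hg, fun _ hf => lift_injective (hf.trans (lift_descend g hg).symm)⟩
-/

/-! ## Continuity and smoothness through the lift -/

section Smooth

omit [DecidableEq d]

variable [TopologicalSpace F] in
omit [Fintype d] in
/-- `f` is continuous iff its lift is (`proj` is an open quotient map). [folklore] -/
theorem continuous_lift_iff {f : UnitAddTorus d → F} : Continuous (lift f) ↔ Continuous f :=
  isOpenQuotientMap_proj.continuous_comp_iff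

variable [NormedAddCommGroup F] [NormedSpace ℝ F]

/-- Smoothness of a function on the torus: its periodic lift is `C^∞` on `ℝ^d`
(Grafakos, §3.1: `C^∞(T^n)` = smooth `1`-periodic functions). [folklore] -/
def IsSmooth (f : UnitAddTorus d → F) : Prop := ContDiff ℝ ∞ (lift f)

/-- `C^n` regularity of a function on the torus (`n : WithTop ℕ∞`, so `n = ω` is analytic):
its periodic lift is `C^n` on `ℝ^d`. [folklore] -/
def IsContDiff (n : WithTop ℕ∞) (f : UnitAddTorus d → F) : Prop := ContDiff ℝ n (lift f)

/-- `IsSmooth f ↔ IsContDiff ∞ f`. [folklore] -/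
theorem isSmooth_iff_isContDiff {f : UnitAddTorus d → F} : IsSmooth f ↔ IsContDiff ∞ f := Iff.rfl

/-- A smooth function is `C^n` for every `n ≤ ∞`. [folklore] -/
theorem IsSmooth.isContDiff {f : UnitAddTorus d → F} (hf : IsSmooth f) {n : WithTop ℕ∞}
    (hn : n ≤ ∞) : IsContDiff n f :=
  ContDiff.of_le hf hn

/-- `IsContDiff` is monotone in the exponent. [folklore] -/
theorem IsContDiff.of_le {f : UnitAddTorus d → F} {m n : WithTop ℕ∞} (hf : IsContDiff n f)
    (hmn : m ≤ n) : IsContDiff m f :=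
  ContDiff.of_le hf hmn

/-- Regularity of the re-centred lift equals regularity of the global lift (they differ by a
translation of `ℝ^d`). [folklore] -/
theorem contDiff_liftAt_iff {n : WithTop ℕ∞} {f : UnitAddTorus d → F} (x : UnitAddTorus d) :
    ContDiff ℝ n (liftAt f x) ↔ ContDiff ℝ n (lift f) := by
  obtain ⟨y, rfl⟩ := proj_surjective x
  rw [liftAt_proj]
  refine ⟨fun h => ?_, fun h => h.comp (contDiff_const.add contDiff_id)⟩
  have : lift f = (lift f ∘ (y + ·)) ∘ (-y + ·) := by
    funext v
    simp
  rw [this]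
  exact h.comp (contDiff_const.add contDiff_id)

/-- The re-centred lifts of a smooth function are smooth. [folklore] -/
theorem IsSmooth.liftAt {f : UnitAddTorus d → F} (hf : IsSmooth f) (x : UnitAddTorus d) :
    ContDiff ℝ ∞ (liftAt f x) :=
  (contDiff_liftAt_iff x).2 hf

/-- The re-centred lifts of a `C^n` function are `C^n`. [folklore] -/
theorem IsContDiff.liftAt {n : WithTop ℕ∞} {f : UnitAddTorus d → F} (hf : IsContDiff n f)
    (x : UnitAddTorus d) : ContDiff ℝ n (liftAt f x) :=
  (contDiff_liftAt_iff x).2 hf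

/-- `C^n` functions on the torus are continuous. [folklore] -/
theorem IsContDiff.continuous {n : WithTop ℕ∞} {f : UnitAddTorus d → F} (hf : IsContDiff n f) :
    Continuous f :=
  continuous_lift_iff.1 (ContDiff.continuous hf)

/-- Smooth functions on the torus are continuous. [folklore] -/
theorem IsSmooth.continuous {f : UnitAddTorus d → F} (hf : IsSmooth f) : Continuous f :=
  IsContDiff.continuous hf

/-- Constants are smooth. [folklore] -/
theorem isSmooth_const (c : F) : IsSmooth (fun _ : UnitAddTorus d => c) := contDiff_const

/-- Constants are `C^n`. [folklore] -/
theorem isContDiff_const {n : WithTop ℕ∞} (c : F) : IsContDiff n (fun _ : UnitAddTorus d => c) :=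
  contDiff_const

/-- Sums of smooth functions are smooth. [folklore] -/
theorem IsSmooth.add {f g : UnitAddTorus d → F} (hf : IsSmooth f) (hg : IsSmooth g) :
    IsSmooth (f + g) :=
  ContDiff.add hf hg

/-- Negatives of smooth functions are smooth. [folklore] -/
theorem IsSmooth.neg {f : UnitAddTorus d → F} (hf : IsSmooth f) : IsSmooth (-f) :=
  ContDiff.neg hf

/-- Differences of smooth functions are smooth. [folklore] -/
theorem IsSmooth.sub {f g : UnitAddTorus d → F} (hf : IsSmooth f) (hg : IsSmooth g) :
    IsSmooth (f - g) :=
  ContDiff.sub hf hg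

/-- Scalar multiples of smooth functions are smooth. [folklore] -/
theorem IsSmooth.smul {f : UnitAddTorus d → F} (c : ℝ) (hf : IsSmooth f) : IsSmooth (c • f) :=
  ContDiff.const_smul c hf

/-- Products of a smooth scalar function and a smooth vector function are smooth. [folklore] -/
theorem IsSmooth.smul' {θ : UnitAddTorus d → ℝ} {f : UnitAddTorus d → F} (hθ : IsSmooth θ)
    (hf : IsSmooth f) : IsSmooth (fun x => θ x • f x) :=
  ContDiff.smul hθ hf

/-- Post-composition with a continuous linear map preserves smoothness. [folklore] -/
theorem IsSmooth.comp_clm {G : Type*} [NormedAddCommGroup G] [NormedSpace ℝ G]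
    {f : UnitAddTorus d → F} (L : F →L[ℝ] G) (hf : IsSmooth f) : IsSmooth (L ∘ f) :=
  L.contDiff.comp hf

/-- Sums of `C^n` functions are `C^n`. [folklore] -/
theorem IsContDiff.add {n : WithTop ℕ∞} {f g : UnitAddTorus d → F} (hf : IsContDiff n f)
    (hg : IsContDiff n g) : IsContDiff n (f + g) :=
  ContDiff.add hf hg

/-- Scalar multiples of `C^n` functions are `C^n`. [folklore] -/
theorem IsContDiff.smul {n : WithTop ℕ∞} {f : UnitAddTorus d → F} (c : ℝ) (hf : IsContDiff n f) :
    IsContDiff n (c • f) :=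
  ContDiff.const_smul c hf

/-- Translates of smooth functions are smooth: `x ↦ f (x + a)`. [folklore] -/
theorem IsSmooth.comp_add_right {f : UnitAddTorus d → F} (hf : IsSmooth f) (a : UnitAddTorus d) :
    IsSmooth (fun x => f (x + a)) := by
  obtain ⟨b, rfl⟩ := proj_surjective a
  have : lift (fun x => f (x + proj b)) = lift f ∘ (b + ·) := by
    funext v
    simp [add_comm]
  unfold IsSmooth
  rw [this]
  exact ContDiff.comp hf (contDiff_const.add contDiff_id)

/-- The Fourier characters `mFourier k : T^d → ℂ`, `x ↦ ∏ᵢ exp (2πi kᵢ xᵢ)`, are smooth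
(Grafakos, §3.1). [folklore] -/
theorem isSmooth_mFourier (k : d → ℤ) :
    IsSmooth (⇑(UnitAddTorus.mFourier k) : UnitAddTorus d → ℂ) := by
  unfold IsSmooth lift
  simp only [UnitAddTorus.mFourier, ContinuousMap.coe_mk, Function.comp_def, proj,
    fourier_coe_apply]
  refine contDiff_prod fun i _ => ContDiff.cexp ?_
  refine ContDiff.div_const (ContDiff.mul contDiff_const ?_) _
  exact Complex.ofRealCLM.contDiff.comp (contDiff_piLp_apply 2)

end Smooth

/-! ## Measure and integration -/

section Measure

omit [DecidableEq d]

/-- The global `volume` on `T^d` is the product of the normalised Haar measures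
`AddCircle.haarAddCircle` (the local `volume` of `Mathlib.Analysis.Fourier.AddCircleMulti`);
this is the transport lemma between H21's global-`volume` convention and Mathlib's
`UnitAddTorus.mFourier*` API. [folklore] -/
theorem volume_eq_pi_haarAddCircle :
    (volume : Measure (UnitAddTorus d)) = Measure.pi fun _ : d => AddCircle.haarAddCircle := by
  have h : (volume : Measure UnitAddCircle) = AddCircle.haarAddCircle := by
    rw [AddCircle.volume_eq_smul_haarAddCircle]
    simp
  change Measure.pi (fun _ : d => (volume : Measure UnitAddCircle)) = _
  simp_rw [h]

/-- `proj` restricted to the unit cube is measure preserving onto the torus. [cite: Grafakos2014, §3.1.1] -/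
def measurePreserving_proj_unitCube : Prop :=
  MeasurePreserving (proj : EuclideanSpace ℝ d → UnitAddTorus d)
      (volume.restrict (unitCube d)) volume

variable [NormedAddCommGroup F]

/-- Continuous functions on the (compact) torus are integrable. [folklore] -/
theorem _root_.Continuous.integrable_unitAddTorus {f : UnitAddTorus d → F} (hf : Continuous f) :
    Integrable f volume :=
  hf.integrable_of_hasCompactSupport (HasCompactSupport.of_compactSpace f)

variable [NormedSpace ℝ F]

/-- Integration over the torus is integration of the lift over the fundamental domain `[0,1)^d`:
`∫_{T^d} f = ∫_{[0,1)^d} f ∘ proj` (Grafakos, §3.1). Not a one-liner: Mathlib's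
`UnitAddTorus.measurePreserving_equivPiIoc` is stated for the local `haarAddCircle` volume; one
transports along `volume_eq_pi_haarAddCircle`. [cite: Grafakos2014, §3.1.1] -/
def integral_eq_integral_lift : Prop :=
  ∀ (f : UnitAddTorus d → F),
    ∫ x, f x = ∫ y in unitCube d, lift f y

/-- Smooth functions on the torus are integrable. [folklore] -/
theorem IsSmooth.integrable {f : UnitAddTorus d → F} (hf : IsSmooth f) : Integrable f volume :=
  hf.continuous.integrable_unitAddTorus

/-- Smooth functions on the torus are in every `L^p`. [folklore] -/
theorem IsSmooth.memLp {f : UnitAddTorus d → F} (hf : IsSmooth f) (p : ENNReal) :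
    MemLp f p volume := by
  borelize F
  exact hf.continuous.memLp_of_hasCompactSupport (HasCompactSupport.of_compactSpace f)

/-- `C^n` functions on the torus are integrable. [folklore] -/
theorem IsContDiff.integrable {n : WithTop ℕ∞} {f : UnitAddTorus d → F} (hf : IsContDiff n f) :
    Integrable f volume :=
  hf.continuous.integrable_unitAddTorus

end Measure

end Torus

end

end Literature.Analysis.FunctionSpaces
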